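import Literature.Analysis.FluidPDE.LocalPressureLiouvilleKernel
import Literature.Analysis.UnboundedOperators.HeatKernelGradient
import Literature.Analysis.UnboundedOperators.HeatExtensionDecay
import Literature.Analysis.UnboundedOperators.HeatKernelGradientSmoothing
import Literature.Analysis.FluidPDE.CaloricGradientBoxBounds
import HarnessLib

/-!
# The far field of the caloric extension of uniformly local data

Analysis/FluidPDE proof file (theorems only: no definitions, no named facts — D-0026), a tool for
the compactness proof of the named fact `Literature.Analysis.FluidPDE.BarkerPrange2020_thm2`
(`BarkerPrangeConcentration.lean`; T. Barker, C. Prange, Arch. Ration. Mech. Anal. 236 (2020) =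
arXiv:1812.09115, Theorem 2), namely for the uniform local initial layer of its core
(`BarkerPrangeConcentrationCore.lean`): there the datum `v₀ ∈ L²(ℝ³)` of a local energy solution
is split as `v₀ 1_{B(0,R)} + v₀ 1_{B(0,R)ᶜ}`; the caloric extension of the first piece is small
in Kato's `L⁵_{t,x}` norm, and this file bounds the caloric extension of the SECOND piece — a
field `b ∈ L²(ℝ³)` vanishing on `B(0, R)`, with uniformly local bound
`∫_{B₁(z)} |b|² ≤ A` — together with its gradient, pointwise on the region `|x| + 4 ≤ R` and
for times `0 < t ≤ 1`, by an absolute multiple of `√A` (Gaussian tails against the uniformly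
local weight `(1 + |y - x|)⁻⁴`):

* `heatKernel_le_inv_one_add_norm_pow_four`, `norm_fderiv_heatKernel_le_inv_one_add_norm_pow_four`
  — off the unit ball and for `t ≤ 1`, the heat kernel of `ℝ³` and its gradient are
  `≤ C (1 + |y|)⁻⁴` (`e^{-u} ≤ 4!/u⁴`);
* `exists_norm_heatExtension_far_le`, `exists_norm_fderiv_heatExtension_far_le` — the two
  pointwise bounds `‖e^{tΔ}b(x)‖, ‖∇e^{tΔ}b(x)‖ ≤ K √A`.

## Mathlib / tree search

Tree: `UnboundedOperators.heatKernel_eq`, `norm_fderiv_heatKernel_le`, `heatExtension_apply`,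
`norm_fderiv_heatExtension_le`, `pow_mul_exp_neg_le_factorial`,
`exists_lintegral_mul_inv_one_add_norm_pow_le` (the uniformly local weight lemma)
(`lean search 'heatExtension.*far|farField.*heat|uloc.*heatExtension'`: far-field bounds exist for
bounded or `L³` data — `SereginZhou2020BesovPairing`, `HeatExtensionDecay` — not under uniformly
local `L²` bounds). Mathlib: `norm_integral_le_lintegral_norm`, `lintegral_sub_left_eq_self`,
`Real.rpow_le_rpow_of_nonpos`, `eLpNorm_le_eLpNorm_mul_rpow_measure_univ`.

## References

* T. Barker, C. Prange, ARMA 236 (2020) = arXiv:1812.09115, Thm. 2. [BarkerPrange2020]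
* L. C. Evans, *Partial Differential Equations* (2010), §2.3.1 (the heat kernel). [Evans2010]
-/

noncomputable section

open MeasureTheory Set Function Filter Metric Topology
open scoped ENNReal NNReal Convolution

namespace Literature.Analysis.FluidPDE

namespace BarkerPrange2020

open UnboundedOperators

/-! ### Gaussian tails off the unit ball, `t ≤ 1` -/

/-- `(1 + r)⁴ ≤ 16 r⁴` for `r ≥ 1`. [folklore] -/
theorem one_add_pow_four_le_of_one_le {r : ℝ} (hr : 1 ≤ r) : (1 + r) ^ 4 ≤ 16 * r ^ 4 := by
  have h : 1 + r ≤ 2 * r := by linarith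
  calc (1 + r) ^ 4 ≤ (2 * r) ^ 4 := pow_le_pow_left₀ (by linarith) h 4
    _ = 16 * r ^ 4 := by ring

/-- `u⁴ e^{-u} ≤ 24` for `u ≥ 0`, in the form `e^{-u} ≤ 24 / u⁴` (`u > 0`). (The tree has the
same inequality in `Literature/NumberTheory/LFunctions/MoebiusHarmonicSumBound.lean`; restated with
the product on the left to keep this analysis file independent of that import.) [folklore] -/
theorem pow_four_mul_exp_neg_le {u : ℝ} (hu : 0 ≤ u) : u ^ 4 * Real.exp (-u) ≤ 24 := by
  have h := pow_mul_exp_neg_le_factorial hu 4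
  have e : ((Nat.factorial 4 : ℕ) : ℝ) = 24 := by norm_num [Nat.factorial]
  rwa [e] at h

/-- `t^{-a} · t^{b} ≤ 1` bookkeeping: `t^{-3/2} (4t)⁴ ≤ 256` for `0 < t ≤ 1`. [folklore] -/
theorem rpow_neg_three_halves_mul_pow_four_le {t : ℝ} (ht : 0 < t) (ht1 : t ≤ 1) :
    t ^ (-(3 : ℝ) / 2) * (4 * t) ^ 4 ≤ 256 := by
  have e1 : (4 * t) ^ 4 = 256 * t ^ (4 : ℝ) := by
    rw [mul_pow, show (t ^ 4 : ℝ) = t ^ (4 : ℝ) by norm_cast]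
    norm_num
  have e2 : t ^ (-(3 : ℝ) / 2) * t ^ (4 : ℝ) = t ^ ((5 : ℝ) / 2) := by
    rw [← Real.rpow_add ht]; norm_num
  have h52 : t ^ ((5 : ℝ) / 2) ≤ 1 := Real.rpow_le_one ht.le ht1 (by norm_num)
  calc t ^ (-(3 : ℝ) / 2) * (4 * t) ^ 4 = 256 * (t ^ (-(3 : ℝ) / 2) * t ^ (4 : ℝ)) := by
        rw [e1]; ring
    _ = 256 * t ^ ((5 : ℝ) / 2) := by rw [e2]
    _ ≤ 256 * 1 := by gcongr
    _ = 256 := by ring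

/-- `t^{-3/2} t^{-1/2} (8t)⁴ ≤ 4096` for `0 < t ≤ 1`. [folklore] -/
theorem rpow_neg_two_mul_pow_four_le {t : ℝ} (ht : 0 < t) (ht1 : t ≤ 1) :
    t ^ (-(3 : ℝ) / 2) * (Real.sqrt t)⁻¹ * (8 * t) ^ 4 ≤ 4096 := by
  have e0 : (Real.sqrt t)⁻¹ = t ^ (-(1 / 2 : ℝ)) := by
    rw [Real.sqrt_eq_rpow, Real.rpow_neg ht.le]
  have e1 : (8 * t) ^ 4 = 4096 * t ^ (4 : ℝ) := by
    rw [mul_pow, show (t ^ 4 : ℝ) = t ^ (4 : ℝ) by norm_cast]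
    norm_num
  have e2 : t ^ (-(3 : ℝ) / 2) * t ^ (-(1 / 2 : ℝ)) * t ^ (4 : ℝ) = t ^ (2 : ℝ) := by
    rw [← Real.rpow_add ht, ← Real.rpow_add ht]; norm_num
  have h2 : t ^ (2 : ℝ) ≤ 1 := Real.rpow_le_one ht.le ht1 (by norm_num)
  calc t ^ (-(3 : ℝ) / 2) * (Real.sqrt t)⁻¹ * (8 * t) ^ 4
      = 4096 * (t ^ (-(3 : ℝ) / 2) * t ^ (-(1 / 2 : ℝ)) * t ^ (4 : ℝ)) := by rw [e0, e1]; ring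
    _ = 4096 * t ^ (2 : ℝ) := by rw [e2]
    _ ≤ 4096 * 1 := by gcongr
    _ = 4096 := by ring

/-- **The heat kernel of `ℝ³` off the unit ball, for `t ≤ 1`**:
`G_t(y) ≤ 98304 (1 + |y|)⁻⁴` for `|y| ≥ 1`, `0 < t ≤ 1` (`(4πt)^{-3/2} ≤ t^{-3/2}`,
`e^{-|y|²/4t} ≤ 24 (4t)⁴/|y|⁸`, `t^{5/2} ≤ 1`, `|y|⁻⁸ ≤ |y|⁻⁴ ≤ 16 (1 + |y|)⁻⁴`). [cite: Evans2010, §2.3.1 (the heat kernel)] -/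
theorem heatKernel_le_inv_one_add_norm_pow_four {t : ℝ} (ht : 0 < t) (ht1 : t ≤ 1)
    {y : EuclideanSpace ℝ (Fin 3)} (hy : 1 ≤ ‖y‖) :
    heatKernel t y ≤ 98304 * ((1 + ‖y‖) ^ 4)⁻¹ := by
  set r : ℝ := ‖y‖ with hr
  have hr0 : 0 < r := lt_of_lt_of_le one_pos hy
  rw [heatKernel_eq, finrank_euclideanSpace_fin]
  push_cast
  have hpre : (4 * Real.pi * t) ^ (-(3 : ℝ) / 2) ≤ t ^ (-(3 : ℝ) / 2) := by
    refine Real.rpow_le_rpow_of_nonpos ht ?_ (by norm_num)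
    nlinarith [Real.pi_gt_three]
  set u : ℝ := 1 / (4 * t) * r ^ 2 with hu
  have hu0 : 0 < u := by positivity
  have hexp : Real.exp (-(1 / (4 * t)) * r ^ 2) ≤ 24 * (4 * t) ^ 4 / r ^ 8 := by
    have e1 : -(1 / (4 * t)) * r ^ 2 = -u := by rw [hu]; ring
    rw [e1]
    have hq : Real.exp (-u) ≤ 24 / u ^ 4 := by
      rw [le_div_iff₀ (by positivity), mul_comm]
      exact pow_four_mul_exp_neg_le hu0.le
    refine hq.trans (le_of_eq ?_)
    rw [hu]
    field_simp
  have hr48 : r ^ 4 ≤ r ^ 8 := by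
    calc r ^ 4 = r ^ 4 * 1 := (mul_one _).symm
      _ ≤ r ^ 4 * r ^ 4 := by gcongr; exact one_le_pow₀ hy
      _ = r ^ 8 := by ring
  have h16 := one_add_pow_four_le_of_one_le hy
  calc (4 * Real.pi * t) ^ (-(3 : ℝ) / 2) * Real.exp (-(1 / (4 * t)) * r ^ 2)
      ≤ t ^ (-(3 : ℝ) / 2) * (24 * (4 * t) ^ 4 / r ^ 8) :=
        mul_le_mul hpre hexp (Real.exp_pos _).le (Real.rpow_nonneg ht.le _)
    _ = 24 * (t ^ (-(3 : ℝ) / 2) * (4 * t) ^ 4) / r ^ 8 := by ring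
    _ ≤ 24 * 256 / r ^ 8 := by gcongr; exact rpow_neg_three_halves_mul_pow_four_le ht ht1
    _ ≤ 24 * 256 / r ^ 4 := div_le_div_of_nonneg_left (by norm_num) (by positivity) hr48
    _ ≤ 98304 / (1 + r) ^ 4 := by
        rw [div_le_div_iff₀ (by positivity) (by positivity)]
        nlinarith
    _ = 98304 * ((1 + r) ^ 4)⁻¹ := by rw [div_eq_mul_inv]

/-- **The gradient of the heat kernel of `ℝ³` off the unit ball, for `t ≤ 1`**:
`‖∇G_t(y)‖ ≤ 1572864 (1 + |y|)⁻⁴` for `|y| ≥ 1`, `0 < t ≤ 1`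
(`‖∇G_t(y)‖ ≤ (4πt)^{-3/2} t^{-1/2} e^{-|y|²/8t}`, `norm_fderiv_heatKernel_le`). [cite: Evans2010, §2.3.1 (the heat kernel)] -/
theorem norm_fderiv_heatKernel_le_inv_one_add_norm_pow_four {t : ℝ} (ht : 0 < t) (ht1 : t ≤ 1)
    {y : EuclideanSpace ℝ (Fin 3)} (hy : 1 ≤ ‖y‖) :
    ‖fderiv ℝ (heatKernel t) y‖ ≤ 1572864 * ((1 + ‖y‖) ^ 4)⁻¹ := by
  set r : ℝ := ‖y‖ with hr
  have hr0 : 0 < r := lt_of_lt_of_le one_pos hy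
  refine (norm_fderiv_heatKernel_le ht y).trans ?_
  rw [finrank_euclideanSpace_fin]
  push_cast
  have hpre : (4 * Real.pi * t) ^ (-(3 : ℝ) / 2) ≤ t ^ (-(3 : ℝ) / 2) := by
    refine Real.rpow_le_rpow_of_nonpos ht ?_ (by norm_num)
    nlinarith [Real.pi_gt_three]
  set u : ℝ := 1 / (8 * t) * r ^ 2 with hu
  have hu0 : 0 < u := by positivity
  have hexp : Real.exp (-(1 / (8 * t)) * r ^ 2) ≤ 24 * (8 * t) ^ 4 / r ^ 8 := by
    have e1 : -(1 / (8 * t)) * r ^ 2 = -u := by rw [hu]; ring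
    rw [e1]
    have hq : Real.exp (-u) ≤ 24 / u ^ 4 := by
      rw [le_div_iff₀ (by positivity), mul_comm]
      exact pow_four_mul_exp_neg_le hu0.le
    refine hq.trans (le_of_eq ?_)
    rw [hu]
    field_simp
  have hr48 : r ^ 4 ≤ r ^ 8 := by
    calc r ^ 4 = r ^ 4 * 1 := (mul_one _).symm
      _ ≤ r ^ 4 * r ^ 4 := by gcongr; exact one_le_pow₀ hy
      _ = r ^ 8 := by ring
  have h16 := one_add_pow_four_le_of_one_le hy
  have hsq : 0 ≤ (Real.sqrt t)⁻¹ := by positivity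
  calc (4 * Real.pi * t) ^ (-(3 : ℝ) / 2) * (Real.sqrt t)⁻¹ * Real.exp (-(1 / (8 * t)) * r ^ 2)
      ≤ t ^ (-(3 : ℝ) / 2) * (Real.sqrt t)⁻¹ * (24 * (8 * t) ^ 4 / r ^ 8) :=
        mul_le_mul (mul_le_mul_of_nonneg_right hpre hsq) hexp (Real.exp_pos _).le
          (mul_nonneg (Real.rpow_nonneg ht.le _) hsq)
    _ = 24 * (t ^ (-(3 : ℝ) / 2) * (Real.sqrt t)⁻¹ * (8 * t) ^ 4) / r ^ 8 := by ring
    _ ≤ 24 * 4096 / r ^ 8 := by gcongr; exact rpow_neg_two_mul_pow_four_le ht ht1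
    _ ≤ 24 * 4096 / r ^ 4 := div_le_div_of_nonneg_left (by norm_num) (by positivity) hr48
    _ ≤ 1572864 / (1 + r) ^ 4 := by
        rw [div_le_div_iff₀ (by positivity) (by positivity)]
        nlinarith
    _ = 1572864 * ((1 + r) ^ 4)⁻¹ := by rw [div_eq_mul_inv]

/-! ### The far field of the caloric extension -/

/-- **Unit-ball `L¹` bounds from unit-ball `L²` bounds**: `∫_{B₁(z)} |b| ≤ (A |B₁|)^{1/2}`.
[folklore] -/
theorem lintegral_unitBall_enorm_le_sqrt {b : EuclideanSpace ℝ (Fin 3) → EuclideanSpace ℝ (Fin 3)}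
    (hb : AEStronglyMeasurable b volume) {A : ℝ≥0∞}
    (hA : ∀ z : EuclideanSpace ℝ (Fin 3), ∫⁻ y in ball z 1, ‖b y‖ₑ ^ 2 ≤ A)
    (z : EuclideanSpace ℝ (Fin 3)) :
    ∫⁻ y in ball z 1, ‖b y‖ₑ ≤ (A * volume (ball (0 : EuclideanSpace ℝ (Fin 3)) 1)) ^ (1 / 2 : ℝ) := by
  set μ : Measure (EuclideanSpace ℝ (Fin 3)) := volume.restrict (ball z 1) with hμ
  have h := eLpNorm_le_eLpNorm_mul_rpow_measure_univ (by norm_num : (1 : ℝ≥0∞) ≤ 2)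
    (hb.restrict : AEStronglyMeasurable b μ)
  rw [eLpNorm_one_eq_lintegral_enorm] at h
  have hexp : (1 / (1 : ℝ≥0∞).toReal - 1 / (2 : ℝ≥0∞).toReal : ℝ) = 1 / 2 := by norm_num
  have hvol : μ univ = volume (ball (0 : EuclideanSpace ℝ (Fin 3)) 1) := by
    rw [hμ, Measure.restrict_apply_univ, Measure.addHaar_ball_center]
  rw [hexp, hvol] at h
  -- `‖b‖_{L²(B)} ≤ A^{1/2}`
  have hsq : ∫⁻ y, ‖b y‖ₑ ^ 2 ∂μ = eLpNorm b 2 μ ^ 2 := by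
    rw [eLpNorm_eq_lintegral_rpow_enorm_toReal (by norm_num) (by norm_num), ENNReal.toReal_ofNat,
      ← ENNReal.rpow_natCast, ← ENNReal.rpow_mul]
    norm_num
  have h2 : eLpNorm b 2 μ ≤ A ^ (1 / 2 : ℝ) := by
    have h1 := ENNReal.rpow_le_rpow (z := (1 / 2 : ℝ)) (hsq.symm.le.trans (hA z)) (by norm_num)
    rwa [← ENNReal.rpow_natCast, ← ENNReal.rpow_mul,
      show ((2 : ℕ) : ℝ) * (1 / 2) = 1 by norm_num, ENNReal.rpow_one] at h1
  calc ∫⁻ y, ‖b y‖ₑ ∂μ ≤ eLpNorm b 2 μ * volume (ball (0 : EuclideanSpace ℝ (Fin 3)) 1) ^ (1 / 2 : ℝ) := h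
    _ ≤ A ^ (1 / 2 : ℝ) * volume (ball (0 : EuclideanSpace ℝ (Fin 3)) 1) ^ (1 / 2 : ℝ) := by gcongr
    _ = (A * volume (ball (0 : EuclideanSpace ℝ (Fin 3)) 1)) ^ (1 / 2 : ℝ) :=
        (ENNReal.mul_rpow_of_nonneg _ _ (by norm_num)).symm

/-- Off-support points are far: if `b = 0` on `B(0, R)`, `|x| + 4 ≤ R` and `b(x - y) ≠ 0`, then
`|y| ≥ 1` (indeed `≥ 4`). [folklore] -/
theorem one_le_norm_of_apply_sub_ne_zero {b : EuclideanSpace ℝ (Fin 3) → EuclideanSpace ℝ (Fin 3)}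
    {R : ℝ} (hb0 : ∀ y ∈ ball (0 : EuclideanSpace ℝ (Fin 3)) R, b y = 0)
    {x : EuclideanSpace ℝ (Fin 3)} (hx : ‖x‖ + 4 ≤ R) {y : EuclideanSpace ℝ (Fin 3)}
    (hy : b (x - y) ≠ 0) : 1 ≤ ‖y‖ := by
  by_contra h
  rw [not_le] at h
  refine hy (hb0 _ ?_)
  rw [mem_ball_zero_iff]
  calc ‖x - y‖ ≤ ‖x‖ + ‖y‖ := norm_sub_le _ _
    _ < ‖x‖ + 4 := by linarith
    _ ≤ R := hx

/-- **The weighted tail integral after the substitution `y ↦ x - y`**: for the weight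
`w_x(y) = (1 + |y - x|)⁻⁴`, `∫ |b(x - y)| (1 + |y|)⁻⁴ dy = ∫ |b(y)| w_x(y) dy`. [folklore] -/
theorem lintegral_enorm_sub_mul_weight_eq (b : EuclideanSpace ℝ (Fin 3) → EuclideanSpace ℝ (Fin 3))
    (x : EuclideanSpace ℝ (Fin 3)) :
    ∫⁻ y, ‖b (x - y)‖ₑ * ENNReal.ofReal (((1 + ‖y‖) ^ 4)⁻¹) =
      ∫⁻ y, ‖b y‖ₑ * ENNReal.ofReal (((1 + ‖y - x‖) ^ 4)⁻¹) := by
  have h := lintegral_sub_left_eq_self (μ := (volume : Measure (EuclideanSpace ℝ (Fin 3))))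
    (fun y : EuclideanSpace ℝ (Fin 3) => ‖b y‖ₑ * ENNReal.ofReal (((1 + ‖y - x‖) ^ 4)⁻¹)) x
  refine Eq.trans (lintegral_congr fun y => ?_) h
  simp only [sub_sub_cancel_left, norm_neg]

/-- **The far field of the caloric extension of uniformly local data.** There is an absolute `K`
such that: if `b : ℝ³ → ℝ³` is measurable, vanishes on `B(0, R)` and has uniformly local bound
`∫_{B₁(z)} |b|² ≤ A` for all `z`, then for `|x| + 4 ≤ R` and `0 < t ≤ 1`,
`‖e^{tΔ} b (x)‖ ≤ K √A` (the kernel is evaluated only at `|y| ≥ 4 ≥ 1`, where it is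
`≤ C(1 + |y|)⁻⁴`, and `∫ |b| (1 + |y - x|)⁻⁴ ≤ C_w (A|B₁|)^{1/2}`,
`exists_lintegral_mul_inv_one_add_norm_pow_le`). [cite: Evans2010, §2.3.1 (the heat kernel)] -/
theorem exists_norm_heatExtension_far_le :
    ∃ K : ℝ, 0 ≤ K ∧ ∀ (b : EuclideanSpace ℝ (Fin 3) → EuclideanSpace ℝ (Fin 3)) (R : ℝ) (A : ℝ≥0)
      (x : EuclideanSpace ℝ (Fin 3)) (t : ℝ),
      AEStronglyMeasurable b volume →
      (∀ y ∈ ball (0 : EuclideanSpace ℝ (Fin 3)) R, b y = 0) →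
      (∀ z : EuclideanSpace ℝ (Fin 3), ∫⁻ y in ball z 1, ‖b y‖ₑ ^ 2 ≤ (A : ℝ≥0∞)) →
      ‖x‖ + 4 ≤ R → 0 < t → t ≤ 1 →
      ‖heatExtension b t x‖ ≤ K * Real.sqrt A := by
  obtain ⟨Cw, hCwtop, hCw⟩ := exists_lintegral_mul_inv_one_add_norm_pow_le
  set V : ℝ≥0∞ := volume (ball (0 : EuclideanSpace ℝ (Fin 3)) 1) with hV
  have hVtop : V ≠ ∞ := measure_ball_lt_top.ne
  refine ⟨98304 * Cw.toReal * Real.sqrt V.toReal, by positivity, ?_⟩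
  intro b R A x t hbm hb0 hA hx ht ht1
  set A₁ : ℝ≥0∞ := ((A : ℝ≥0∞) * V) ^ (1 / 2 : ℝ) with hA₁
  have hA₁top : A₁ ≠ ∞ :=
    ENNReal.rpow_ne_top_of_nonneg (by norm_num) (ENNReal.mul_ne_top ENNReal.coe_ne_top hVtop)
  have hL1 : ∀ z : EuclideanSpace ℝ (Fin 3), ∫⁻ y in ball z 1, ‖b y‖ₑ ≤ A₁ :=
    lintegral_unitBall_enorm_le_sqrt hbm hA
  -- pointwise bound of the integrand
  have hpt : ∀ y : EuclideanSpace ℝ (Fin 3), ‖heatKernel t y • b (x - y)‖ₑ ≤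
      ENNReal.ofReal 98304 * (‖b (x - y)‖ₑ * ENNReal.ofReal (((1 + ‖y‖) ^ 4)⁻¹)) := by
    intro y
    by_cases h0 : b (x - y) = 0
    · rw [h0, smul_zero, enorm_zero]; exact bot_le
    · have hy := one_le_norm_of_apply_sub_ne_zero hb0 hx h0
      have hK0 : 0 ≤ heatKernel t y := (heatKernel_pos ht y).le
      rw [enorm_smul, Real.enorm_eq_ofReal hK0]
      calc ENNReal.ofReal (heatKernel t y) * ‖b (x - y)‖ₑ
          ≤ ENNReal.ofReal (98304 * ((1 + ‖y‖) ^ 4)⁻¹) * ‖b (x - y)‖ₑ := by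
            gcongr; exact heatKernel_le_inv_one_add_norm_pow_four ht ht1 hy
        _ = ENNReal.ofReal 98304 * (‖b (x - y)‖ₑ * ENNReal.ofReal (((1 + ‖y‖) ^ 4)⁻¹)) := by
            rw [ENNReal.ofReal_mul (by norm_num)]; ring
  -- the lower integral of the integrand
  have hlin : ∫⁻ y, ‖heatKernel t y • b (x - y)‖ₑ ≤ ENNReal.ofReal 98304 * (Cw * A₁) := by
    calc ∫⁻ y, ‖heatKernel t y • b (x - y)‖ₑ
        ≤ ∫⁻ y, ENNReal.ofReal 98304 * (‖b (x - y)‖ₑ * ENNReal.ofReal (((1 + ‖y‖) ^ 4)⁻¹)) :=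
          lintegral_mono hpt
      _ = ENNReal.ofReal 98304 * ∫⁻ y, ‖b y‖ₑ * ENNReal.ofReal (((1 + ‖y - x‖) ^ 4)⁻¹) := by
          rw [lintegral_const_mul' _ _ ENNReal.ofReal_ne_top, lintegral_enorm_sub_mul_weight_eq]
      _ ≤ ENNReal.ofReal 98304 * (Cw * A₁) := by
          gcongr; exact hCw (fun y => ‖b y‖ₑ) hbm.enorm A₁ hL1 x
  -- conclusion
  have hfin : ENNReal.ofReal 98304 * (Cw * A₁) ≠ ∞ :=
    ENNReal.mul_ne_top ENNReal.ofReal_ne_top (ENNReal.mul_ne_top hCwtop hA₁top)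
  have hA₁r : A₁.toReal = Real.sqrt A * Real.sqrt V.toReal := by
    rw [hA₁, ← ENNReal.toReal_rpow, ENNReal.toReal_mul, ENNReal.coe_toReal,
      Real.mul_rpow A.coe_nonneg ENNReal.toReal_nonneg, Real.sqrt_eq_rpow, Real.sqrt_eq_rpow]
  calc ‖heatExtension b t x‖ = ‖∫ y, heatKernel t y • b (x - y)‖ := by rw [heatExtension_apply]
    _ ≤ (∫⁻ y, ‖heatKernel t y • b (x - y)‖ₑ).toReal := by
        have h := norm_integral_le_lintegral_norm (μ := volume) fun y => heatKernel t y • b (x - y)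
        simpa only [ofReal_norm] using h
    _ ≤ (ENNReal.ofReal 98304 * (Cw * A₁)).toReal := ENNReal.toReal_mono hfin hlin
    _ = 98304 * Cw.toReal * Real.sqrt V.toReal * Real.sqrt A := by
        rw [ENNReal.toReal_mul, ENNReal.toReal_mul, ENNReal.toReal_ofReal (by norm_num), hA₁r]
        ring

/-- **The gradient of the far field of the caloric extension of uniformly local data.** With an
absolute `K`: for `b ∈ L²(ℝ³; ℝ³)` vanishing on `B(0, R)` with `∫_{B₁(z)} |b|² ≤ A` for all `z`,
`|x| + 4 ≤ R` and `0 < t ≤ 1`, `‖∇ e^{tΔ} b (x)‖ ≤ K √A` (differentiation under the integral,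
`norm_fderiv_heatExtension_le`, and the same tail estimate with the gradient kernel bound).
[cite: Evans2010, §2.3.1 (the heat kernel)] -/
theorem exists_norm_fderiv_heatExtension_far_le :
    ∃ K : ℝ, 0 ≤ K ∧ ∀ (b : EuclideanSpace ℝ (Fin 3) → EuclideanSpace ℝ (Fin 3)) (R : ℝ) (A : ℝ≥0)
      (x : EuclideanSpace ℝ (Fin 3)) (t : ℝ),
      MemLp b 2 volume →
      (∀ y ∈ ball (0 : EuclideanSpace ℝ (Fin 3)) R, b y = 0) →
      (∀ z : EuclideanSpace ℝ (Fin 3), ∫⁻ y in ball z 1, ‖b y‖ₑ ^ 2 ≤ (A : ℝ≥0∞)) →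
      ‖x‖ + 4 ≤ R → 0 < t → t ≤ 1 →
      ‖fderiv ℝ (heatExtension b t) x‖ ≤ K * Real.sqrt A := by
  obtain ⟨Cw, hCwtop, hCw⟩ := exists_lintegral_mul_inv_one_add_norm_pow_le
  set V : ℝ≥0∞ := volume (ball (0 : EuclideanSpace ℝ (Fin 3)) 1) with hV
  have hVtop : V ≠ ∞ := measure_ball_lt_top.ne
  refine ⟨1572864 * Cw.toReal * Real.sqrt V.toReal, by positivity, ?_⟩
  intro b R A x t hb2 hb0 hA hx ht ht1
  have hbm : AEStronglyMeasurable b volume := hb2.aestronglyMeasurable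
  set A₁ : ℝ≥0∞ := ((A : ℝ≥0∞) * V) ^ (1 / 2 : ℝ) with hA₁
  have hA₁top : A₁ ≠ ∞ :=
    ENNReal.rpow_ne_top_of_nonneg (by norm_num) (ENNReal.mul_ne_top ENNReal.coe_ne_top hVtop)
  have hL1 : ∀ z : EuclideanSpace ℝ (Fin 3), ∫⁻ y in ball z 1, ‖b y‖ₑ ≤ A₁ :=
    lintegral_unitBall_enorm_le_sqrt hbm hA
  -- the integrand of `‖∇G_t‖ ⋆ ‖b‖` at `x`
  set F : EuclideanSpace ℝ (Fin 3) → ℝ := fun y => ‖fderiv ℝ (heatKernel t) y‖ * ‖b (x - y)‖ with hF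
  have hF0 : ∀ y, 0 ≤ F y := fun y => by positivity
  have hFm : AEStronglyMeasurable F volume := by
    refine ((continuous_fderiv_heatKernel t).norm.aestronglyMeasurable).mul ?_
    exact (hbm.norm.comp_quasiMeasurePreserving
      (quasiMeasurePreserving_sub_left (volume : Measure (EuclideanSpace ℝ (Fin 3))) x))
  have hconv : ((fun y => ‖fderiv ℝ (heatKernel t) y‖) ⋆[ContinuousLinearMap.lsmul ℝ ℝ, volume]
      (fun y => ‖b y‖)) x = ∫ y, F y := by
    rw [convolution_def]
    rfl
  -- pointwise bound
  have hpt : ∀ y : EuclideanSpace ℝ (Fin 3), ENNReal.ofReal (F y) ≤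
      ENNReal.ofReal 1572864 * (‖b (x - y)‖ₑ * ENNReal.ofReal (((1 + ‖y‖) ^ 4)⁻¹)) := by
    intro y
    by_cases h0 : b (x - y) = 0
    · rw [hF]; dsimp only; rw [h0, norm_zero, mul_zero, ENNReal.ofReal_zero]; exact bot_le
    · have hy := one_le_norm_of_apply_sub_ne_zero hb0 hx h0
      rw [hF]; dsimp only
      rw [ENNReal.ofReal_mul (norm_nonneg _), ofReal_norm, ofReal_norm]
      calc ‖fderiv ℝ (heatKernel t) y‖ₑ * ‖b (x - y)‖ₑ
          ≤ ENNReal.ofReal (1572864 * ((1 + ‖y‖) ^ 4)⁻¹) * ‖b (x - y)‖ₑ := by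
            rw [← ofReal_norm]
            gcongr; exact norm_fderiv_heatKernel_le_inv_one_add_norm_pow_four ht ht1 hy
        _ = ENNReal.ofReal 1572864 * (‖b (x - y)‖ₑ * ENNReal.ofReal (((1 + ‖y‖) ^ 4)⁻¹)) := by
            rw [ENNReal.ofReal_mul (by norm_num)]; ring
  have hlin : ∫⁻ y, ENNReal.ofReal (F y) ≤ ENNReal.ofReal 1572864 * (Cw * A₁) := by
    calc ∫⁻ y, ENNReal.ofReal (F y)
        ≤ ∫⁻ y, ENNReal.ofReal 1572864 * (‖b (x - y)‖ₑ * ENNReal.ofReal (((1 + ‖y‖) ^ 4)⁻¹)) :=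
          lintegral_mono hpt
      _ = ENNReal.ofReal 1572864 * ∫⁻ y, ‖b y‖ₑ * ENNReal.ofReal (((1 + ‖y - x‖) ^ 4)⁻¹) := by
          rw [lintegral_const_mul' _ _ ENNReal.ofReal_ne_top, lintegral_enorm_sub_mul_weight_eq]
      _ ≤ ENNReal.ofReal 1572864 * (Cw * A₁) := by
          gcongr; exact hCw (fun y => ‖b y‖ₑ) hbm.enorm A₁ hL1 x
  have hfin : ENNReal.ofReal 1572864 * (Cw * A₁) ≠ ∞ :=
    ENNReal.mul_ne_top ENNReal.ofReal_ne_top (ENNReal.mul_ne_top hCwtop hA₁top)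
  have hA₁r : A₁.toReal = Real.sqrt A * Real.sqrt V.toReal := by
    rw [hA₁, ← ENNReal.toReal_rpow, ENNReal.toReal_mul, ENNReal.coe_toReal,
      Real.mul_rpow A.coe_nonneg ENNReal.toReal_nonneg, Real.sqrt_eq_rpow, Real.sqrt_eq_rpow]
  calc ‖fderiv ℝ (heatExtension b t) x‖
      ≤ ((fun y => ‖fderiv ℝ (heatKernel t) y‖) ⋆[ContinuousLinearMap.lsmul ℝ ℝ, volume]
          (fun y => ‖b y‖)) x := norm_fderiv_heatExtension_le hb2 (by norm_num) ht x
    _ = ∫ y, F y := hconv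
    _ = (∫⁻ y, ENNReal.ofReal (F y)).toReal :=
        integral_eq_lintegral_of_nonneg_ae (Eventually.of_forall hF0) hFm
    _ ≤ (ENNReal.ofReal 1572864 * (Cw * A₁)).toReal := ENNReal.toReal_mono hfin hlin
    _ = 1572864 * Cw.toReal * Real.sqrt V.toReal * Real.sqrt A := by
        rw [ENNReal.toReal_mul, ENNReal.toReal_mul, ENNReal.toReal_ofReal (by norm_num), hA₁r]
        ring

/-! ### Local caloric bounds for data split into an `L³` near field and an `L²_uloc` far field -/

/-- **Local heat-kernel bounds for split data.** There are universal constants `C₆, C_g, K` such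
that for every datum `v₀ ∈ L²(ℝ³)` with `‖v₀‖_{L³(B(0,R))} ≤ γ` and
`sup_z ∫_{B(z,1)} |v₀|² ≤ A`, every centre `x₀` with `|x₀| + 7 ≤ R` and every `0 < t ≤ 1`, the
caloric extension `e(t) = e^{tΔ}v₀` satisfies on the ball `B = B(x₀, 3)`:
`‖e(t)‖_{L³(B)} ≤ γ + K√A`, `‖e(t)‖_{L⁶(B)} ≤ (C₆γ + K√A) t^{-1/4}`,
`‖∇e(t)‖_{L³(B)} ≤ (C_gγ + K√A) t^{-1/2}`. Proof: `v₀ = v₀1_{B(0,R)} + v₀1_{B(0,R)ᶜ}`; the near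
part is an `L³` datum of norm `≤ γ` (`L³ → L³`, `L³ → L⁶` and gradient `L³ → L³` heat-kernel
bounds), the far part has `|e|, |∇e| ≤ K₀√A` on `B` (`exists_norm_heatExtension_far_le`,
`exists_norm_fderiv_heatExtension_far_le`) and `t^{-1/4}, t^{-1/2} ≥ 1`.
[cite: BarkerPrange2020, §4.2 (arXiv:1812.09115 p. 16); Evans2010, §2.3.1] -/
theorem exists_local_caloric_bounds_of_split :
    ∃ C₆ Cg K : ℝ≥0, ∀ (γ A : ℝ≥0) (R : ℝ) (v₀ : EuclideanSpace ℝ (Fin 3) → EuclideanSpace ℝ (Fin 3))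
      (x₀ : EuclideanSpace ℝ (Fin 3)),
      MemLp v₀ 2 volume →
      eLpNorm v₀ 3 (volume.restrict (ball (0 : EuclideanSpace ℝ (Fin 3)) R)) ≤ γ →
      (∀ z : EuclideanSpace ℝ (Fin 3), ∫⁻ y in ball z 1, ‖v₀ y‖ₑ ^ 2 ≤ (A : ℝ≥0∞)) →
      ‖x₀‖ + 7 ≤ R → ∀ t : ℝ, 0 < t → t ≤ 1 →
        eLpNorm (heatExtension v₀ t) 3 (volume.restrict (ball x₀ 3)) ≤ ((γ + K * NNReal.sqrt A : ℝ≥0) : ℝ≥0∞) ∧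
        eLpNorm (heatExtension v₀ t) 6 (volume.restrict (ball x₀ 3)) ≤
          ((C₆ * γ + K * NNReal.sqrt A : ℝ≥0) : ℝ≥0∞) * ENNReal.ofReal (t ^ (-(1 / 4 : ℝ))) ∧
        eLpNorm (fderiv ℝ (heatExtension v₀ t)) 3 (volume.restrict (ball x₀ 3)) ≤
          ((Cg * γ + K * NNReal.sqrt A : ℝ≥0) : ℝ≥0∞) * ENNReal.ofReal (t ^ (-(1 / 2 : ℝ))) := by
  obtain ⟨K₀, hK₀0, hK₀⟩ := exists_norm_heatExtension_far_le
  obtain ⟨K₁, hK₁0, hK₁⟩ := exists_norm_fderiv_heatExtension_far_le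
  obtain ⟨C36, hC36⟩ := UnboundedOperators.eLpNorm_heatExtension_le_rpow_holds
    (E := EuclideanSpace ℝ (Fin 3)) (F := EuclideanSpace ℝ (Fin 3)) (p := 3) (q := 6) (by norm_num) (by norm_num)
  obtain ⟨Cg, hCg⟩ := UnboundedOperators.exists_eLpNorm_fderiv_heatExtension_le_rpow
    (E := EuclideanSpace ℝ (Fin 3)) (F := EuclideanSpace ℝ (Fin 3)) (p := 3) (q := 3) (by norm_num) le_rfl
  set V : ℝ≥0∞ := volume (ball (0 : EuclideanSpace ℝ (Fin 3)) 3) with hV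
  have hVfin : V ≠ ∞ := measure_ball_lt_top.ne
  set Vn : ℝ≥0 := V.toNNReal with hVn
  have hVcoe : (Vn : ℝ≥0∞) = V := ENNReal.coe_toNNReal hVfin
  set K : ℝ≥0 := (Vn ^ (1 / 3 : ℝ) + Vn ^ (1 / 6 : ℝ)) * (Real.toNNReal K₀ + Real.toNNReal K₁) with hK
  refine ⟨C36, Cg, K, ?_⟩
  intro γ A R v₀ x₀ hv₀ hγ hA hx₀ t ht ht1
  -- the splitting
  set a : EuclideanSpace ℝ (Fin 3) → EuclideanSpace ℝ (Fin 3) := (ball (0 : EuclideanSpace ℝ (Fin 3)) R).indicator v₀ with ha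
  set b : EuclideanSpace ℝ (Fin 3) → EuclideanSpace ℝ (Fin 3) := (ball (0 : EuclideanSpace ℝ (Fin 3)) R)ᶜ.indicator v₀ with hb
  have hab : a + b = v₀ := Set.indicator_self_add_compl _ _
  have ha2 : MemLp a 2 volume := hv₀.indicator measurableSet_ball
  have hb2 : MemLp b 2 volume := hv₀.indicator measurableSet_ball.compl
  have ha3eq : eLpNorm a 3 volume = eLpNorm v₀ 3 (volume.restrict (ball (0 : EuclideanSpace ℝ (Fin 3)) R)) :=
    eLpNorm_indicator_eq_eLpNorm_restrict measurableSet_ball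
  have ha3 : MemLp a 3 volume := by
    refine ⟨hv₀.1.indicator measurableSet_ball, ?_⟩
    rw [ha3eq]
    exact hγ.trans_lt ENNReal.coe_lt_top
  have haγ : eLpNorm a 3 volume ≤ γ := ha3eq ▸ hγ
  have hb0 : ∀ y ∈ ball (0 : EuclideanSpace ℝ (Fin 3)) R, b y = 0 := fun y hy =>
    Set.indicator_of_notMem (Set.notMem_compl_iff.2 hy) _
  have hbA : ∀ z : EuclideanSpace ℝ (Fin 3), ∫⁻ y in ball z 1, ‖b y‖ₑ ^ 2 ≤ (A : ℝ≥0∞) := fun z =>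
    (lintegral_mono fun y => pow_le_pow_left' (enorm_indicator_le_enorm_self _ _) 2).trans (hA z)
  have hsplit : heatExtension v₀ t = heatExtension a t + heatExtension b t := by
    funext y
    rw [← hab]
    exact heatExtension_add_apply_of_memLp ha2 hb2 (by norm_num) (by norm_num) ht y
  have hda : Differentiable ℝ (heatExtension a t) :=
    (UnboundedOperators.contDiff_heatExtension_holds ha2 (by norm_num) ht).differentiable (by simp)
  have hdb : Differentiable ℝ (heatExtension b t) :=
    (UnboundedOperators.contDiff_heatExtension_holds hb2 (by norm_num) ht).differentiable (by simp)
  have hDsplit : fderiv ℝ (heatExtension v₀ t) = fderiv ℝ (heatExtension a t) + fderiv ℝ (heatExtension b t) := by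
    funext y
    rw [hsplit]
    exact fderiv_add (hda y) (hdb y)
  have hca : Continuous (heatExtension a t) := hda.continuous
  have hcb : Continuous (heatExtension b t) := hdb.continuous
  have hcDa : Continuous (fderiv ℝ (heatExtension a t)) :=
    (UnboundedOperators.contDiff_heatExtension_holds ha2 (by norm_num) ht).continuous_fderiv (by simp)
  have hcDb : Continuous (fderiv ℝ (heatExtension b t)) :=
    (UnboundedOperators.contDiff_heatExtension_holds hb2 (by norm_num) ht).continuous_fderiv (by simp)
  -- the ball
  set B : Set (EuclideanSpace ℝ (Fin 3)) := ball x₀ 3 with hBdef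
  have hvolB : (volume.restrict B) univ = V := by
    rw [Measure.restrict_apply_univ, hBdef, hV]; exact Measure.addHaar_ball_center volume x₀ 3
  have hxB : ∀ y ∈ B, ‖y‖ + 4 ≤ R := fun y hy => by
    have h1 : ‖y‖ ≤ ‖x₀‖ + 3 := by
      have := norm_le_norm_add_norm_sub' y x₀  -- ‖y‖ ≤ ‖x₀‖ + ‖y - x₀‖
      have h2 : ‖y - x₀‖ < 3 := by rwa [← dist_eq_norm]
      linarith
    linarith
  -- far parts: pointwise bounds on `B`, hence `Lᵖ(B)` bounds
  have far_p : ∀ {F' : Type} [NormedAddCommGroup F'] {f : EuclideanSpace ℝ (Fin 3) → F'} {K' : ℝ} (p : ℝ≥0∞),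
      0 ≤ K' → (∀ y ∈ B, ‖f y‖ ≤ K' * Real.sqrt A) →
      eLpNorm f p (volume.restrict B) ≤ V ^ p.toReal⁻¹ * ((Real.toNNReal K' * NNReal.sqrt A : ℝ≥0) : ℝ≥0∞) := by
    intro F' _ f K' p hK' hf
    have h1 := eLpNorm_le_of_ae_bound (μ := volume.restrict B) (p := p) (f := f) (C := K' * Real.sqrt A)
      ((ae_restrict_iff' measurableSet_ball).2 (Eventually.of_forall hf))
    rw [hvolB] at h1
    refine h1.trans (le_of_eq ?_)
    congr 1
    rw [ENNReal.ofReal, Real.toNNReal_mul hK', ← Real.coe_sqrt, Real.toNNReal_coe]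
  have hKdom' : ∀ (r : ℝ) (K' : ℝ), (r = 1 / 3 ∨ r = 1 / 6) → (K' = K₀ ∨ K' = K₁) →
      Vn ^ r * Real.toNNReal K' ≤ K := by
    intro r K' hr hK'
    rw [hK]
    refine mul_le_mul' ?_ ?_
    · rcases hr with h | h <;> rw [h]
      · exact le_self_add
      · exact le_add_self
    · rcases hK' with h | h <;> rw [h]
      · exact le_self_add
      · exact le_add_self
  have hKdom : ∀ (r : ℝ) (K' : ℝ), (r = 1 / 3 ∨ r = 1 / 6) → (K' = K₀ ∨ K' = K₁) →
      V ^ r * ((Real.toNNReal K' * NNReal.sqrt A : ℝ≥0) : ℝ≥0∞) ≤ ((K * NNReal.sqrt A : ℝ≥0) : ℝ≥0∞) := by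
    intro r K' hr hK'
    rw [← hVcoe, ← ENNReal.coe_rpow_of_nonneg _ (by rcases hr with h | h <;> rw [h] <;> norm_num), ← ENNReal.coe_mul,
      ENNReal.coe_le_coe, ← mul_assoc]
    exact mul_le_mul_of_nonneg_right (hKdom' r K' hr hK') bot_le
  have hBfar : eLpNorm (heatExtension b t) 3 (volume.restrict B) ≤ ((K * NNReal.sqrt A : ℝ≥0) : ℝ≥0∞) := by
    have h1 := far_p 3 hK₀0 (fun y hy => hK₀ b R A y t hb2.1 hb0 hbA (hxB y hy) ht ht1)
    simp only [ENNReal.toReal_ofNat] at h1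
    exact h1.trans (by simpa using hKdom (1 / 3) K₀ (Or.inl rfl) (Or.inl rfl))
  have hBfar6 : eLpNorm (heatExtension b t) 6 (volume.restrict B) ≤ ((K * NNReal.sqrt A : ℝ≥0) : ℝ≥0∞) := by
    have h1 := far_p 6 hK₀0 (fun y hy => hK₀ b R A y t hb2.1 hb0 hbA (hxB y hy) ht ht1)
    simp only [ENNReal.toReal_ofNat] at h1
    exact h1.trans (by simpa using hKdom (1 / 6) K₀ (Or.inr rfl) (Or.inl rfl))
  have hBfarD : eLpNorm (fderiv ℝ (heatExtension b t)) 3 (volume.restrict B) ≤ ((K * NNReal.sqrt A : ℝ≥0) : ℝ≥0∞) := by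
    have h1 := far_p 3 hK₁0 (fun y hy => hK₁ b R A y t hb2 hb0 hbA (hxB y hy) ht ht1)
    simp only [ENNReal.toReal_ofNat] at h1
    exact h1.trans (by simpa using hKdom (1 / 3) K₁ (Or.inl rfl) (Or.inr rfl))
  -- `t^{-1/4}, t^{-1/2} ≥ 1`
  have ht4 : (1 : ℝ≥0∞) ≤ ENNReal.ofReal (t ^ (-(1 / 4 : ℝ))) := by
    rw [← ENNReal.ofReal_one]
    exact ENNReal.ofReal_le_ofReal (Real.one_le_rpow_of_pos_of_le_one_of_nonpos ht ht1 (by norm_num))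
  have ht2 : (1 : ℝ≥0∞) ≤ ENNReal.ofReal (t ^ (-(1 / 2 : ℝ))) := by
    rw [← ENNReal.ofReal_one]
    exact ENNReal.ofReal_le_ofReal (Real.one_le_rpow_of_pos_of_le_one_of_nonpos ht ht1 (by norm_num))
  -- near parts
  have hnear3 : eLpNorm (heatExtension a t) 3 (volume.restrict B) ≤ γ :=
    ((eLpNorm_mono_measure _ Measure.restrict_le_self).trans
      (UnboundedOperators.eLpNorm_heatExtension_le_holds ha3 (by norm_num) ht)).trans haγ
  have hnear6 : eLpNorm (heatExtension a t) 6 (volume.restrict B) ≤ (C36 : ℝ≥0∞) * ENNReal.ofReal (t ^ (-(1 / 4 : ℝ))) * γ := by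
    have h1 := hC36 a ha3 t ht
    have hexp : -((Module.finrank ℝ (EuclideanSpace ℝ (Fin 3)) : ℝ) / 2) *
        ((1 / (3 : ℝ≥0∞)).toReal - (1 / (6 : ℝ≥0∞)).toReal) = -(1 / 4 : ℝ) := by
      rw [finrank_euclideanSpace_fin]; norm_num [ENNReal.toReal_div, ENNReal.toReal_ofNat]
    rw [hexp] at h1
    exact ((eLpNorm_mono_measure _ Measure.restrict_le_self).trans h1).trans (mul_le_mul' le_rfl haγ)
  have hnearD : eLpNorm (fderiv ℝ (heatExtension a t)) 3 (volume.restrict B) ≤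
      (Cg : ℝ≥0∞) * ENNReal.ofReal (t ^ (-(1 / 2 : ℝ))) * γ := by
    have h1 := hCg a ha3 t ht
    have hexp : -(1 / 2 + (Module.finrank ℝ (EuclideanSpace ℝ (Fin 3)) : ℝ) / 2 *
        ((1 / (3 : ℝ≥0∞)).toReal - (1 / (3 : ℝ≥0∞)).toReal)) = -(1 / 2 : ℝ) := by
      rw [finrank_euclideanSpace_fin]; norm_num
    rw [hexp] at h1
    exact ((eLpNorm_mono_measure _ Measure.restrict_le_self).trans h1).trans (mul_le_mul' le_rfl haγ)
  -- assembling
  refine ⟨?_, ?_, ?_⟩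
  · rw [hsplit]
    refine (eLpNorm_add_le hca.aestronglyMeasurable hcb.aestronglyMeasurable (by norm_num)).trans ?_
    refine (add_le_add hnear3 hBfar).trans (le_of_eq ?_)
    push_cast; ring
  · rw [hsplit]
    refine (eLpNorm_add_le hca.aestronglyMeasurable hcb.aestronglyMeasurable (by norm_num)).trans ?_
    calc eLpNorm (heatExtension a t) 6 (volume.restrict B) + eLpNorm (heatExtension b t) 6 (volume.restrict B)
        ≤ (C36 : ℝ≥0∞) * ENNReal.ofReal (t ^ (-(1 / 4 : ℝ))) * γ +
            ((K * NNReal.sqrt A : ℝ≥0) : ℝ≥0∞) * ENNReal.ofReal (t ^ (-(1 / 4 : ℝ))) :=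
          add_le_add hnear6 (hBfar6.trans (le_mul_of_one_le_right bot_le ht4))
      _ = _ := by push_cast; ring
  · rw [hDsplit]
    refine (eLpNorm_add_le hcDa.aestronglyMeasurable hcDb.aestronglyMeasurable (by norm_num)).trans ?_
    calc eLpNorm (fderiv ℝ (heatExtension a t)) 3 (volume.restrict B) + eLpNorm (fderiv ℝ (heatExtension b t)) 3 (volume.restrict B)
        ≤ (Cg : ℝ≥0∞) * ENNReal.ofReal (t ^ (-(1 / 2 : ℝ))) * γ +
            ((K * NNReal.sqrt A : ℝ≥0) : ℝ≥0∞) * ENNReal.ofReal (t ^ (-(1 / 2 : ℝ))) :=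
          add_le_add hnearD (hBfarD.trans (le_mul_of_one_le_right bot_le ht2))
      _ = _ := by push_cast; ring

end BarkerPrange2020

end Literature.Analysis.FluidPDE

end
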